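import Summits.FinalStateConjecture.FinalStateConjecture.Theorems.PhotonSphereChannelsChannelsResolveTameDevelopmentsRKerrDevBasics
import Summits.FinalStateConjecture.FinalStateConjecture.Theorems.PhotonSphereChannelsChannelsResolveTameDevelopmentsRGlobalCloseness
import Literature.Geometry.Lorentzian.MinkowskiCauchyDevelopment
import Literature.Geometry.Manifold.OpenSubmanifoldMFDeriv
import HarnessLib

/-!
# Route PhotonSphereChannels · crux `ChannelsResolveTameDevelopmentsR` (K2R, stmt-FinalStateConjecture-14075) — the anchored
# Kerr window deviation VANISHES ON THE EXACT MODELS (line `kerr-isolation-dichotomy`, lead c2; sub-goals of stub S2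
# `stub_kerrIsolation`)

Stub S2 of the skeleton `Cruxes/ChannelsResolveTameDevelopmentsR/Lines/kerr_isolation_dichotomy.lean` (GLOBAL ISOLATION)
ends with the conjunct `∀ p ∈ closure E.doc, ∀ R, kerrDev 𝓢 p R = 0` for an end whose domain of outer communications is an
exact Kerr exterior (`IsKerrDoc 𝓢 E.doc M a`) or for Minkowski space (`IsMinkowski 𝓢`). This file proves the honest
OPEN-REGION part of that conjunct — the anti-vacuity certificates of the whole line (S2's conclusion realised on the exact
members of the class; the antecedents of S4/S5/S6 on the Minkowski development) — over the vocabulary of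
`Theorems/PhotonSphereChannelsKerrDevDefs.lean` (`IsWindowChart`, `anchoredDev`, `kerrDev`) and
`Theorems/PhotonSphereChannelsTameHullDefs.lean` (`IsKerrDoc`, `IsMinkowski`); nothing is posited, no new definition:

* §1 **exact Kerr regions** (registered sub-goal `stub_kerrDev_eq_zero_of_isKerrDoc`): if `O ⊆ 𝓢` is an exact Kerr
  `(M, a)` exterior, `0 ≤ M`, `|a| ≤ M`, then `kerrDev 𝓢 p R = 0` for every `p ∈ O` and every scale `R` — the isometric
  chart `Ψ` of `IsKerrDoc` is itself an anchored window chart at `p = Ψ x₀` (`isWindowChart_of_isKerrDoc`) whose deviation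
  `Ψ^* g − g_{M,a}` vanishes identically, so its window `C²` sup norm is `0` (`anchoredDev_eq_zero_of_isKerrDoc`, no sign
  hypothesis) and `kerrDev ≤ anchoredDev · M a` at admissible parameters (`kerrDev_le_anchoredDev`); the same for an end
  globally `0`-close to Kerr (`kerrDev_eq_zero_of_isGloballyClose_zero`, via S3's `stub_isGloballyClose_zero_iff_isKerrDoc`);
* §2 **exactly flat charts** (`kerrDev_eq_zero_of_flatChart`): if `Ψ : E4 → 𝓢` is smooth, injective, time-oriented
  (`Ψ_* ∂₀` future-directed) with `Ψ^* g − η = 0`, then `kerrDev 𝓢 (Ψ y) R = 0` for all `y`, `R` — at the flat parameters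
  `M = a = 0` (`Kerr.exterior 0 0 = ℝ_t × {x⃗ ≠ 0}`, `g_{0,0} = η` by `Kerr.bilin_zero_left`) the TRANSLATED chart
  `x ↦ Ψ ((y − x₀) + x)` anchored at `x₀ = (0, 1, 0, 0)` is an anchored window chart at `Ψ y`
  (`isWindowChart_translate`; chain rule `d(Ψ ∘ (q + ·) ∘ ι)_x = dΨ_{q+x}`, `mfderiv_comp_translate_subtypeVal`) with
  identically vanishing deviation (`deviation_translate_eq_zero`); hence (registered sub-goal
  `stub_kerrDev_eq_zero_of_isMinkowski`) `IsMinkowski 𝓢 ⇒ kerrDev 𝓢 p R = 0` everywhere, and the same on the d.o.c. of a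
  globally `0`-flat end (`kerrDev_eq_zero_of_isGloballyFlat_zero`);
* §3 **the model** (registered sub-goal `stub_kerrDev_minkowski_eq_zero`): `IsMinkowski Minkowski.spacetime` by the
  identity chart (`isMinkowski_minkowskiSpacetime`), so `kerrDev Minkowski.spacetime p R = 0`, also in the form
  `kerrDev Minkowski.vacuumCauchyDevelopment.toSpacetime p R = 0` consumed by the development-level stubs S4–S6
  (`kerrDev_minkowskiVacuumCauchyDevelopment_eq_zero`; `Minkowski.vacuumCauchyDevelopment.toSpacetime = Minkowski.spacetime`
  is `rfl`, `MinkowskiCauchyDevelopment.lean`).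

Not here (next rung, reported to the lead): the CLOSURE points `p ∈ closure E.doc ∖ E.doc` of S2's conjunct (future-horizon
points of the Kerr black-hole patch, where no exactly isometric exterior chart is anchored and `kerrDev = 0` needs charts
whose `C²` window deviation is only ARBITRARILY SMALL).

References: the predicates paraphrase Dafermos–Luk, arXiv:1710.01722, Conjecture 1 [DafermosLuk2017] and Christodoulou–
Klainerman 1993, Thm. 1.0.2 [ChristodoulouKlainerman1993]; the `Cᵏ` deviation norms are those of DHRT arXiv:2104.08222, §1
[arXiv210408222]; open submanifolds and the chain rule: O'Neill 1983, Ch. 1 p. 4, Ch. 3 p. 58 [ONeill1983] (the identity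
differential of the inclusion of an open submanifold is the Mathlib-only `Literature/Geometry/Manifold/OpenSubmanifoldMFDeriv`);
Minkowski space and its time orientation: Hawking–Ellis 1973, §5.1 [HawkingEllis1973].
-/

noncomputable section

-- the operator-norm instance on `E4 →L[ℝ] E4 →L[ℝ] ℝ` needs one more level of pending
-- instance problems than the default (as in `PhotonSphereChannelsKerrDevDefs.lean`)
set_option maxSynthPendingDepth 3
-- every `Summit.FinalStateConjecture.FinalStateConjecture.…` name repeats the summit = sub-problem segment (D-0017 layout)
set_option linter.dupNamespace false

open Set Filter Function TopologicalSpace Manifold Bundle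
open scoped Topology Manifold ContDiff ENNReal NNReal

namespace Summit.FinalStateConjecture.FinalStateConjecture.Theorems

open Literature.Geometry.Lorentzian
open Summit.FinalStateConjecture.FinalStateConjecture.Theorems.TameHull

/-! ### §1 Exact Kerr regions -/

/-- The isometric chart of an exact Kerr `(M, a)` region is an anchored window chart at each of its values, at every
scale (anchor `rfl`; smooth and injective on the whole exterior; `Ψ_* ∂_{t*}` future-directed outside the ergoregion).
[cite: DafermosLuk2017, Conjecture 1] -/
theorem isWindowChart_of_isKerrDoc {𝓢 : Spacetime.{0} 4} {M a : ℝ} {Ψ : Kerr.exterior M a → 𝓢.carrier}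
    (hsmooth : ContMDiff 𝓘(ℝ, E4) (𝓡 4) ∞ Ψ) (hinj : Injective Ψ)
    (hfut : ∀ x : Kerr.exterior M a, 2 * M < Kerr.radius a x.1 →
      𝓢.timeOrientation.IsFutureDirected (mfderiv 𝓘(ℝ, E4) (𝓡 4) Ψ x (E4.basisVector 0)))
    (x₀ : Kerr.exterior M a) (R : ℝ) : IsWindowChart 𝓢 M a x₀ R (Ψ x₀) Ψ :=
  ⟨rfl, hsmooth.contMDiffOn, hinj.injOn, fun x _ hr ↦ hfut x hr⟩

/-- **On an exact Kerr `(M, a)` region the anchored deviation at the parameters `(M, a)` vanishes at every point and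
every scale** (no sign hypothesis on the parameters): the isometric chart of `IsKerrDoc`, anchored at the preimage of the
point, has identically vanishing deviation `Ψ^* g − g_{M,a}`, whose extension by zero is the zero function
(`deviationExtend_eq_zero`) with window `C²` sup norm `0`. [cite: DafermosLuk2017, Conjecture 1] -/
theorem anchoredDev_eq_zero_of_isKerrDoc {𝓢 : Spacetime.{0} 4} {O : Set 𝓢.carrier} {M a : ℝ}
    (h : IsKerrDoc 𝓢 O M a) {p : 𝓢.carrier} (hp : p ∈ O) (R : ℝ) : anchoredDev 𝓢 p M a R = 0 := by
  obtain ⟨Ψ, hinj, hsmooth, hrange, hdev, hfut⟩ := h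
  rw [← hrange] at hp
  obtain ⟨x₀, rfl⟩ := hp
  refine nonpos_iff_eq_zero.1 ?_
  refine (iInf_le_of_le x₀ <| iInf_le_of_le Ψ <|
    iInf_le _ (isWindowChart_of_isKerrDoc hsmooth hinj hfut x₀ R)).trans (le_of_eq ?_)
  rw [deviationExtend_eq_zero hdev, supCkENorm_zero]

/-- **Registered sub-goal `stub_kerrDev_eq_zero_of_isKerrDoc` of S2 (`stub_kerrIsolation`).** On an exact Kerr `(M, a)`
region with ADMISSIBLE parameters `0 ≤ M`, `|a| ≤ M` (sub-extremal, extremal and `M = 0` included) the anchored Kerr window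
deviation vanishes at every point and every scale: `kerrDev ≤ anchoredDev · M a = 0` (`kerrDev_le_anchoredDev`,
`anchoredDev_eq_zero_of_isKerrDoc`). This is the open-region part of S2's conjunct `∀ p ∈ closure E.doc, kerrDev 𝓢 p R = 0`
in the Kerr alternative. [cite: DafermosLuk2017, Conjecture 1] -/
theorem stub_kerrDev_eq_zero_of_isKerrDoc :
    ∀ {𝓢 : Spacetime.{0} 4} {O : Set 𝓢.carrier} {M a : ℝ}, 0 ≤ M → |a| ≤ M → IsKerrDoc 𝓢 O M a →
      ∀ p ∈ O, ∀ R : ℝ, kerrDev 𝓢 p R = 0 := by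
  intro 𝓢 O M a hM ha h p hp R
  exact nonpos_iff_eq_zero.1
    ((kerrDev_le_anchoredDev p M a R hM ha).trans_eq (anchoredDev_eq_zero_of_isKerrDoc h hp R))

/-- An end GLOBALLY `0`-close to Kerr `(M, a)` with admissible parameters has `kerrDev = 0` at every point of its domain
of outer communications and every scale (`E.IsGloballyClose M a 0 ↔ IsKerrDoc 𝓢 E.doc M a`,
`stub_isGloballyClose_zero_iff_isKerrDoc`). [cite: DafermosLuk2017, Conjecture 1] -/
theorem kerrDev_eq_zero_of_isGloballyClose_zero {𝓢 : Spacetime.{0} 4} (E : EndDatum 𝓢) {M a : ℝ} (hM : 0 ≤ M)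
    (ha : |a| ≤ M) (h : E.IsGloballyClose M a 0) {p : 𝓢.carrier} (hp : p ∈ E.doc) (R : ℝ) :
    kerrDev 𝓢 p R = 0 :=
  stub_kerrDev_eq_zero_of_isKerrDoc hM ha ((stub_isGloballyClose_zero_iff_isKerrDoc E M a).1 h) p hp R

/-! ### §2 Exactly flat charts: the translated chart on the punctured flat model `M = a = 0` -/

section Flat

variable {𝓢 : Spacetime.{0} 4}

/-- **Chain rule for a translated chart restricted to an open subset of `E4`**: for `U ⊆ E4` open, `q ∈ E4` and
`Ψ : E4 → 𝓢` differentiable at `q + x`, the differential at `x ∈ U` of `y ↦ Ψ (q + y)` (through the inclusion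
`ι : U → E4`, `dι = id`, and the translation, `d(q + ·) = id`) is `dΨ_{q + x}`. [cite: ONeill1983, Ch. 1, p. 4] -/
theorem mfderiv_comp_translate_subtypeVal {U : Opens E4} {Ψ : E4 → 𝓢.carrier} (q : E4) (x : U)
    (hΨ : MDifferentiableAt 𝓘(ℝ, E4) (𝓡 4) Ψ (q + (x : E4))) :
    mfderiv 𝓘(ℝ, E4) (𝓡 4) (fun y : U ↦ Ψ (q + (y : E4))) x = mfderiv 𝓘(ℝ, E4) (𝓡 4) Ψ (q + (x : E4)) := by
  -- `d(q + ·) = id` on `E4`, `dι = id` for the inclusion `ι : U → E4` (Lee 2013, Prop. 3.9), chain rule twice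
  have h1 : HasMFDerivAt 𝓘(ℝ, E4) 𝓘(ℝ, E4) (fun y : E4 ↦ q + y) (x : E4) (ContinuousLinearMap.id ℝ E4) :=
    ((hasFDerivAt_id (x : E4)).const_add q).hasMFDerivAt
  have h2 : HasMFDerivAt 𝓘(ℝ, E4) 𝓘(ℝ, E4) (Subtype.val : U → E4) x (ContinuousLinearMap.id ℝ E4) :=
    Literature.Geometry.Manifold.OpenSubmanifold.hasMFDerivAt_subtype_val x
  have h3 := (hΨ.hasMFDerivAt.comp x (h1.comp x h2)).mfderiv
  exact h3.trans (ContinuousLinearMap.ext fun v ↦ rfl)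

variable {Ψ : E4 → 𝓢.carrier}

/-- **The translated chart is an anchored window chart.** For `Ψ : E4 → 𝓢` smooth, injective, with `Ψ_* ∂₀`
future-directed everywhere, every `y ∈ E4`, every anchor `x₀` of the punctured flat model `Kerr.exterior 0 0` and every
scale `R`, the chart `x ↦ Ψ ((y − x₀) + x)` of `Kerr.exterior 0 0` is an anchored window chart at `Ψ y` for the parameters
`M = a = 0`: anchor `(y − x₀) + x₀ = y`; smooth and injective as a composite of such maps with the inclusion; and
`d(Ψ ∘ (q + ·) ∘ ι)_x ∂₀ = dΨ_{q + x} ∂₀` is future-directed. [cite: ONeill1983, Ch. 5, p. 145] -/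
theorem isWindowChart_translate (hsmooth : ContMDiff 𝓘(ℝ, E4) (𝓡 4) ∞ Ψ) (hinj : Injective Ψ)
    (hfut : ∀ x : E4, 𝓢.timeOrientation.IsFutureDirected (mfderiv 𝓘(ℝ, E4) (𝓡 4) Ψ x (E4.basisVector 0)))
    (y : E4) (x₀ : Kerr.exterior 0 0) (R : ℝ) :
    IsWindowChart 𝓢 0 0 x₀ R (Ψ y) (fun x : Kerr.exterior 0 0 ↦ Ψ ((y - x₀.1) + x.1)) := by
  refine ⟨?_, ?_, ?_, fun x _ _ ↦ ?_⟩
  · show Ψ ((y - x₀.1) + x₀.1) = Ψ y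
    rw [sub_add_cancel]
  · exact (hsmooth.comp (((contDiff_const.add contDiff_id).contMDiff :
        ContMDiff 𝓘(ℝ, E4) 𝓘(ℝ, E4) ∞ fun z : E4 ↦ (y - x₀.1) + z).comp
      (contMDiff_subtype_val (I := 𝓘(ℝ, E4)) (n := ∞)))).contMDiffOn
  · exact (hinj.comp ((add_right_injective (y - x₀.1)).comp Subtype.val_injective)).injOn
  · rw [mfderiv_comp_translate_subtypeVal (y - x₀.1) x (hsmooth.mdifferentiableAt (by simp))]
    exact hfut _

/-- **The translated chart has identically vanishing deviation from the flat model.** If moreover `Ψ^* g − η = 0`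
(`Spacetime.minkowskiDeviation Ψ = 0`), then for every `q` the deviation of `x ↦ Ψ (q + x)` from the background
`Kerr.background 0 0 = (Kerr.exterior 0 0, g_{0,0} = η)` vanishes at every point of the punctured flat model: by the chain
rule it is `(Ψ^* g − η)(q + x) = 0` (`Kerr.bilin_zero_left`). [cite: arXiv210408222, §1] -/
theorem deviation_translate_eq_zero (hsmooth : ContMDiff 𝓘(ℝ, E4) (𝓡 4) ∞ Ψ)
    (hdev : ∀ x : E4, 𝓢.minkowskiDeviation Ψ x = 0) (q : E4) (x : Kerr.exterior 0 0) :
    𝓢.deviation (Kerr.background 0 0) (fun x : Kerr.exterior 0 0 ↦ Ψ (q + x.1)) x = 0 := by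
  have hd := mfderiv_comp_translate_subtypeVal (U := Kerr.exterior 0 0) q x (hsmooth.mdifferentiableAt (by simp))
  ext v w
  have h0 := congrArg (fun B : E4 →L[ℝ] E4 →L[ℝ] ℝ ↦ B v w) (hdev (q + x.1))
  rw [Spacetime.minkowskiDeviation_apply] at h0
  change 𝓢.metric.val (Ψ (q + x.1)) (mfderiv 𝓘(ℝ, E4) (𝓡 4) (fun y : Kerr.exterior 0 0 ↦ Ψ (q + y.1)) x v)
      (mfderiv 𝓘(ℝ, E4) (𝓡 4) (fun y : Kerr.exterior 0 0 ↦ Ψ (q + y.1)) x w) - Kerr.bilin 0 0 x.1 v w =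
    (0 : E4 →L[ℝ] E4 →L[ℝ] ℝ) v w
  rw [hd, Kerr.bilin_zero_left]
  exact h0

/-- **`kerrDev` vanishes on the image of an exactly flat, injective, time-oriented chart**: for `Ψ : E4 → 𝓢` smooth,
injective, with `Ψ^* g − η = 0` and `Ψ_* ∂₀` future-directed, `kerrDev 𝓢 (Ψ y) R = 0` for every `y ∈ E4` and every scale
`R`. Witness: the flat parameters `M = a = 0` (admissible), the anchor `x₀ = (0, 1, 0, 0) ∈ Kerr.exterior 0 0`
(`ofTimeSpace_single_mem_exterior_zero`) and the translated chart `x ↦ Ψ ((y − x₀) + x)` (`isWindowChart_translate`),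
whose deviation vanishes identically (`deviation_translate_eq_zero`, `deviationExtend_eq_zero`), so that
`kerrDev ≤ anchoredDev · 0 0 ≤ supCkENorm _ 2 0 = 0`. Covers Minkowski space (`Ψ` bijective) as well as exactly flat
SUB-regions (`Ψ` only injective, e.g. the d.o.c. of a globally `0`-flat end). [cite: ChristodoulouKlainerman1993, Thm. 1.0.2] -/
theorem kerrDev_eq_zero_of_flatChart (hsmooth : ContMDiff 𝓘(ℝ, E4) (𝓡 4) ∞ Ψ) (hinj : Injective Ψ)
    (hdev : ∀ x : E4, 𝓢.minkowskiDeviation Ψ x = 0)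
    (hfut : ∀ x : E4, 𝓢.timeOrientation.IsFutureDirected (mfderiv 𝓘(ℝ, E4) (𝓡 4) Ψ x (E4.basisVector 0)))
    (y : E4) (R : ℝ) : kerrDev 𝓢 (Ψ y) R = 0 := by
  set x₀ : Kerr.exterior 0 0 := ⟨_, ofTimeSpace_single_mem_exterior_zero⟩
  have hΦ := isWindowChart_translate hsmooth hinj hfut y x₀ R
  have h0 : 𝓢.deviationExtend (Kerr.background 0 0) (fun x : Kerr.exterior 0 0 ↦ Ψ ((y - x₀.1) + x.1)) = 0 :=
    deviationExtend_eq_zero (deviation_translate_eq_zero hsmooth hdev (y - x₀.1))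
  have h1 : anchoredDev 𝓢 (Ψ y) 0 0 R ≤ 0 := by
    refine (iInf_le_of_le x₀ <| iInf_le_of_le (fun x : Kerr.exterior 0 0 ↦ Ψ ((y - x₀.1) + x.1)) <|
      iInf_le _ hΦ).trans (le_of_eq ?_)
    rw [h0, supCkENorm_zero]
  exact nonpos_iff_eq_zero.1 ((kerrDev_le_anchoredDev (Ψ y) 0 0 R le_rfl (by rw [abs_zero])).trans h1)

end Flat

/-- **Registered sub-goal `stub_kerrDev_eq_zero_of_isMinkowski` of S2 (`stub_kerrIsolation`).** In Minkowski space
(`IsMinkowski 𝓢`: a smooth, bijective, exactly flat, time-oriented chart `E4 → 𝓢`) the anchored Kerr window deviation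
vanishes at EVERY point and every scale (`kerrDev_eq_zero_of_flatChart` at the preimage of the point) — S2's conjunct
`∀ p ∈ closure E.doc, kerrDev 𝓢 p R = 0` in the Minkowski alternative, for every end `E`.
[cite: ChristodoulouKlainerman1993, Thm. 1.0.2] -/
theorem stub_kerrDev_eq_zero_of_isMinkowski :
    ∀ {𝓢 : Spacetime.{0} 4}, IsMinkowski 𝓢 → ∀ (p : 𝓢.carrier) (R : ℝ), kerrDev 𝓢 p R = 0 := by
  intro 𝓢 h p R
  obtain ⟨Ψ, hbij, hsmooth, hdev, hfut⟩ := h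
  obtain ⟨y, rfl⟩ := hbij.2 p
  exact kerrDev_eq_zero_of_flatChart hsmooth hbij.1 hdev hfut y R

/-- An end GLOBALLY `0`-flat has `kerrDev = 0` at every point of its domain of outer communications and every scale: the
chart of `E.IsGloballyFlat 0` is injective, smooth, time-oriented, onto `E.doc`, and its deviation `Ψ^* g − η` vanishes
identically since its `C²` sup norm over `univ` does (`eq_zero_of_supCkENorm_eq_zero`).
[cite: ChristodoulouKlainerman1993, Thm. 1.0.2] -/
theorem kerrDev_eq_zero_of_isGloballyFlat_zero {𝓢 : Spacetime.{0} 4} (E : EndDatum 𝓢) (h : E.IsGloballyFlat 0)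
    {p : 𝓢.carrier} (hp : p ∈ E.doc) (R : ℝ) : kerrDev 𝓢 p R = 0 := by
  obtain ⟨Ψ, hinj, hsmooth, hrange, hdev, hfut⟩ := h
  rw [← hrange] at hp
  obtain ⟨y, rfl⟩ := hp
  have h0 : supCkENorm (Set.univ : Set E4) 2 (𝓢.minkowskiDeviation Ψ) = 0 := nonpos_iff_eq_zero.1 hdev
  exact kerrDev_eq_zero_of_flatChart hsmooth hinj (fun x ↦ eq_zero_of_supCkENorm_eq_zero h0 (Set.mem_univ x)) hfut y R

/-! ### §3 The model: Minkowski spacetime and the Minkowski vacuum Cauchy development -/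

/-- **Minkowski spacetime `(ℝ⁴, η, ∂ₜ)` is Minkowski space in the sense of `IsMinkowski`**, by the identity chart:
bijective, smooth, `id^* η − η = 0` (`d(id) = id`), and `∂ₜ = ∂₀` is the orienting vector field itself, hence
future-directed. [cite: HawkingEllis1973, §5.1] -/
theorem isMinkowski_minkowskiSpacetime : IsMinkowski Minkowski.spacetime := by
  -- The metric and time orientation of `Minkowski.spacetime` are, by `rfl`, `LorentzianMetric.ofLE Minkowski.metric _`
  -- and `TimeOrientation.ofLE Minkowski.timeOrientation _` on the carrier `E4`; the two auxiliary statements are written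
  -- in that form, so that the instances of `E4` apply syntactically, and transported along `d(id)_x = id`.
  have hd : ∀ x : E4, mfderiv 𝓘(ℝ, E4) 𝓘(ℝ, E4) (fun z : E4 ↦ z) x = ContinuousLinearMap.id ℝ E4 :=
    fun x ↦ (hasFDerivAt_id x).hasMFDerivAt.mfderiv
  have hdev : ∀ (x : E4) (A : E4 →L[ℝ] E4), A = ContinuousLinearMap.id ℝ E4 →
      ((ContinuousLinearMap.precomp ℝ A).comp ((Minkowski.bilin).comp A) : E4 →L[ℝ] E4 →L[ℝ] ℝ) -
        Minkowski.bilin = 0 := by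
    rintro x A rfl
    rw [sub_eq_zero]
    ext v w
    rfl
  have hfut : ∀ (x : E4) (A : E4 →L[ℝ] E4), A = ContinuousLinearMap.id ℝ E4 →
      (TimeOrientation.ofLE (n' := (∞ : ℕ∞ω)) Minkowski.timeOrientation le_top).IsFutureDirected (x := x)
        (A (E4.basisVector 0)) := by
    rintro x A rfl
    exact (TimeOrientation.ofLE (n' := (∞ : ℕ∞ω)) Minkowski.timeOrientation le_top).isFutureDirected_vectorField x
  exact ⟨fun z ↦ z, bijective_id, contMDiff_id, fun x ↦ hdev x _ (hd x), fun x ↦ hfut x _ (hd x)⟩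

/-- **Registered sub-goal `stub_kerrDev_minkowski_eq_zero` of S2 (`stub_kerrIsolation`).** On Minkowski spacetime the
anchored Kerr window deviation vanishes at every point and every scale (`isMinkowski_minkowskiSpacetime` and
`stub_kerrDev_eq_zero_of_isMinkowski`). [cite: HawkingEllis1973, §5.1] -/
theorem stub_kerrDev_minkowski_eq_zero :
    ∀ (p : Minkowski.spacetime.carrier) (R : ℝ), kerrDev Minkowski.spacetime p R = 0 :=
  stub_kerrDev_eq_zero_of_isMinkowski isMinkowski_minkowskiSpacetime

/-- The same for the Minkowski VACUUM CAUCHY DEVELOPMENT of the trivial data (the form in which the development-level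
stubs S4–S6 of the line meet the exact model; `Minkowski.vacuumCauchyDevelopment.toSpacetime = Minkowski.spacetime` by
`rfl`). [cite: HawkingEllis1973, §5.1] -/
theorem kerrDev_minkowskiVacuumCauchyDevelopment_eq_zero :
    ∀ (p : Minkowski.vacuumCauchyDevelopment.carrier) (R : ℝ),
      kerrDev Minkowski.vacuumCauchyDevelopment.toSpacetime p R = 0 :=
  stub_kerrDev_minkowski_eq_zero

end Summit.FinalStateConjecture.FinalStateConjecture.Theorems

end
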